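import Summits.QuantumAdvantage.QuantumAdvantage.Theorems.SosSandwichPseudoBoundedAABlockSymmetricCornerPrep
import HarnessLib

/-!
# Crux `PseudoBoundedAA` (stmt-QuantumAdvantage-15237) / `AAConj` (10748) — the BLOCK-SYMMETRIC CORNER, part 2/2:
# `maxInf ≥ Var²/(64 d² m²)` for bounded polynomials of degree `≤ d` that are symmetric inside each of `m` blocks

Item (3) of the g6 repair census of crux `PseudoBoundedAA` (`SYMMETRIC-CORNER-SHARP-15237.md`: "block-symmetric corner
via an Efron–Stein block decomposition — next natural kernel step").  The tree proves the Aaronson–Ambainis conjecture on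
the SYMMETRIC corner with both exponents sharp (`SymmetricCorner.exists_influence_ge_of_symmetric_sharp`:
`∃ i, Var[p]²/(64 d²) ≤ Inf_i[p]` for weight-symmetric `[0,1]`-bounded `p` of degree `≤ d`, through
`Var[p]·n ≤ 256 d²`).  THIS FILE interpolates between that corner (`m = 1` block) and the general case (`m = N`
singleton blocks, where no symmetry is assumed):

**Theorem (`exists_influence_ge_of_blockSymmetric`).**  Let `blk : [N] → [m]` cut the variables into blocks
`B_j = blk⁻¹(j)` and let `p` be a real polynomial of total degree `≤ d`, `[0,1]`-valued on `{0,1}^N`, whose cube values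
depend only on the block weights `(|x ∩ B_1|, …, |x ∩ B_m|)` (invariance under `S_{B_1} × ⋯ × S_{B_m}`).  If
`Var[p] > 0` then some variable has `Inf_i[p] ≥ Var[p]²/(64 d² m²)`.  Route shapes: `aaConj_blockSymmetricCorner`
(`(c, C) = (2, 1/(64 m²))`) and `pseudoBoundedAA_blockSymmetricCorner` (pseudo-bounded of order `T` ⟹ degree `≤ 2T`;
`(c, C) = (2, 1/(256 m²))`).  So on this corner PB-AA holds with the card's sharp `(ε/T)²` and a loss polynomial in
the NUMBER OF BLOCKS only (not in the block sizes).

PROOF.  Part 1 (`…BlockSymmetricCornerPrep`) gives a block `B = blk⁻¹(j)` with block term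
`V = E_y Var[p|_{B,y}] ≥ Var[p]/m` (Efron–Stein) and identifies the influences of `p` on `B` with `y`-averages of the
influences of the block restrictions `p|_{B,y}`.  Each `p|_{B,y}` is a polynomial in `|B|` variables of degree `≤ d`,
`[0,1]`-valued, and WEIGHT-SYMMETRIC because `p` is block-symmetric (`blockRestrict_symmetric`); by the tree's sharp
symmetric corner `Var[p|_{B,y}]·|B| ≤ 256 d²`, so with Poincaré
`Σ_k Inf_k[p|_{B,y}] ≥ 4 Var[p|_{B,y}] ≥ |B|·Var[p|_{B,y}]²/(64 d²)`; average over `y`, Jensen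
(`E_y Var² ≥ (E_y Var)² = V² ≥ Var[p]²/m²`), and pigeonhole over the `|B|` variables of the block.

Elementary; no named facts; objects inline (no definitions).  Honest label: a corner of an open conjecture (support for
stmt-QuantumAdvantage-15237; no stub/crux/summit closed).
[cite: AaronsonAmbainis2014, Conj. 6] [cite: ODonnell2014, §3.3, §2.3] [cite: KaniewskiLeeDewolf2015, Def. 7]
[cite: Rivlin1974, Sect. 2.7 Remark 2 (2.44)-(2.45)]
-/

-- D-0017: single-conjunct summit ⇒ the duplicate `QuantumAdvantage.QuantumAdvantage` is mandated.
set_option linter.dupNamespace false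

noncomputable section

open Finset MvPolynomial
open Literature.Computability.QuantumComplexity
open Literature.Computability.Complexity.LowDegree Literature.Probability.RandomGraphs.LowDegree
open Summit.QuantumAdvantage.QuantumAdvantage.Cruxes.DecoupledCoreAA.L1Family.Poincare
  (boolVariance_eq_sq_sub four_mul_sq_sub_le_sum_influence)

namespace Summit.QuantumAdvantage.QuantumAdvantage.Theorems.SosSandwich.BlockSymmetricCorner

variable {N : ℕ}

/-! ### §4 The block-symmetric corner -/

/-- Jensen for the square on the cube: `(E v)² ≤ E v²`. [folklore] -/
theorem boolAvg_sq_le_boolAvg_sq (v : (Fin N → Bool) → ℝ) :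
    boolAvg v ^ 2 ≤ boolAvg fun y => v y ^ 2 := by
  have h : 0 ≤ boolAvg (fun x => (v x - boolAvg v) ^ 2) := by
    unfold boolAvg
    exact div_nonneg (Finset.sum_nonneg fun _ _ => sq_nonneg _) (by positivity)
  have hexp : boolAvg (fun x => (v x - boolAvg v) ^ 2) = boolAvg (fun y => v y ^ 2) - boolAvg v ^ 2 := by
    have : (fun x => (v x - boolAvg v) ^ 2) = fun x => 1 * (v x ^ 2) + (-2 * boolAvg v) * v x + boolAvg v ^ 2 := by
      funext x; ring
    rw [this, SymmetricCorner.boolAvg_affine]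
    have : boolAvg (fun x => v x) = boolAvg v := rfl
    rw [this]
    ring
  linarith

/-- `boolAvg` of a finite sum. [folklore] -/
theorem boolAvg_finset_sum {ι : Type*} (s : Finset ι) (f : ι → (Fin N → Bool) → ℝ) :
    boolAvg (fun y => ∑ k ∈ s, f k y) = ∑ k ∈ s, boolAvg (f k) := by
  unfold boolAvg
  rw [Finset.sum_comm, Finset.sum_div]

/-- `boolAvg` is monotone. [folklore] -/
theorem boolAvg_mono {f g : (Fin N → Bool) → ℝ} (h : ∀ y, f y ≤ g y) : boolAvg f ≤ boolAvg g := by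
  unfold boolAvg
  exact div_le_div_of_nonneg_right (Finset.sum_le_sum fun y _ => h y) (by positivity)

/-- Block-weight symmetry of `p` makes every block restriction WEIGHT-SYMMETRIC. [folklore] -/
theorem blockRestrict_symmetric {m : ℕ} (blk : Fin N → Fin m) (p : MvPolynomial (Fin N) ℝ)
    (hsym : ∀ x x' : Fin N → Bool,
      (∀ j : Fin m, (univ.filter fun i => blk i = j ∧ x i = true).card =
        (univ.filter fun i => blk i = j ∧ x' i = true).card) → evalBool p x = evalBool p x')
    (j : Fin m) (B : Finset (Fin N)) (hB : ∀ i, i ∈ B ↔ blk i = j) (y : Fin N → Bool)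
    (z z' : Fin B.card → Bool)
    (hzz : (univ.filter fun k => z k = true).card = (univ.filter fun k => z' k = true).card) :
    evalBool (bind₁ (fun i => if h : i ∈ B then X (B.equivFin ⟨i, h⟩) else C (if y i then (1 : ℝ) else 0)) p) z =
      evalBool (bind₁ (fun i => if h : i ∈ B then X (B.equivFin ⟨i, h⟩) else C (if y i then (1 : ℝ) else 0)) p) z' := by
  rw [evalBool_blockRestrict, evalBool_blockRestrict]
  refine hsym _ _ fun j' => ?_
  -- count block `j'` of the glued points
  have hcount : ∀ w : Fin B.card → Bool,
      (univ.filter fun i => blk i = j' ∧ (fun i' => if h : i' ∈ B then w (B.equivFin ⟨i', h⟩) else y i') i = true).card =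
        if j' = j then (univ.filter fun k => w k = true).card
        else (univ.filter fun i => blk i = j' ∧ y i = true).card := by
    intro w
    split_ifs with hj
    · subst hj
      -- the block coordinates of the glued point are read from `w` through `B.equivFin`
      have hset : (univ.filter fun i => blk i = j' ∧ (fun i' => if h : i' ∈ B then w (B.equivFin ⟨i', h⟩) else y i') i = true) =
          (univ.filter fun k => w k = true).map
            ⟨fun k => (B.equivFin.symm k).1, fun k k' h => by
              have := Subtype.ext h
              simpa using this⟩ := by
        ext i
        simp only [Finset.mem_filter, Finset.mem_univ, true_and, Finset.mem_map, Function.Embedding.coeFn_mk]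
        constructor
        · rintro ⟨hij, hgl⟩
          have hiB : i ∈ B := (hB i).2 hij
          refine ⟨B.equivFin ⟨i, hiB⟩, ?_, by simp⟩
          rwa [dif_pos hiB] at hgl
        · rintro ⟨k, hk, rfl⟩
          have hiB : (B.equivFin.symm k).1 ∈ B := (B.equivFin.symm k).2
          refine ⟨(hB _).1 hiB, ?_⟩
          rw [dif_pos hiB]
          simpa using hk
      rw [hset, Finset.card_map]
    · refine congrArg Finset.card (Finset.filter_congr fun i _ => ?_)
      have h' : ∀ (hi : blk i = j'), (fun i' => if h : i' ∈ B then w (B.equivFin ⟨i', h⟩) else y i') i = y i := fun hi => by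
        have hiB : i ∉ B := fun hmem => hj (hi.symm.trans ((hB i).1 hmem))
        simp only [dif_neg hiB]
      constructor
      · rintro ⟨hi, hg⟩; exact ⟨hi, (h' hi) ▸ hg⟩
      · rintro ⟨hi, hg⟩; exact ⟨hi, (h' hi).symm ▸ hg⟩
  have hz := hcount z
  have hz' := hcount z'
  simp only [] at hz hz'
  rw [hz, hz']
  split_ifs
  · exact hzz
  · rfl

/-- **The Aaronson–Ambainis conjecture on the BLOCK-SYMMETRIC corner.**  Let `p` be a real polynomial of total degree
`≤ d` on `{0,1}^N` with values in `[0,1]`, and let `blk : [N] → [m]` cut the variables into `m` blocks such that the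
cube values of `p` depend only on the block weights `|x ∩ B_1|, …, |x ∩ B_m|` (invariance under every permutation of the
variables inside each block).  If `Var[p] > 0` then some variable has

  `Inf_i[p] ≥ Var[p]² / (64 d² m²)`.

Efron–Stein picks a block `B` with block term `E_y Var[p|_{B,y}] ≥ Var/m`; each restriction `p|_{B,y}` is a
weight-symmetric `[0,1]`-bounded polynomial of degree `≤ d` in `|B|` variables, so `Var[p|_{B,y}]·|B| ≤ 256 d²` (the
tree's sharp symmetric corner) and, with Poincaré, `Σ_k Inf_k[p|_{B,y}] ≥ |B|·Var[p|_{B,y}]²/(64 d²)`; average over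
`y`, Jensen, pigeonhole over `B`.  `m = 1` is the symmetric corner; `m = N` (singletons, no symmetry) gives
`Var²/(64 d² N²)`. [cite: AaronsonAmbainis2014, Conj. 6] [cite: ODonnell2014, §3.3, §2.3]
[cite: Rivlin1974, Sect. 2.7 Remark 2 (2.44)-(2.45)] -/
theorem exists_influence_ge_of_blockSymmetric {m d : ℕ} (blk : Fin N → Fin m) (p : MvPolynomial (Fin N) ℝ)
    (hdeg : p.totalDegree ≤ d) (hb : ∀ x, 0 ≤ evalBool p x ∧ evalBool p x ≤ 1)
    (hsym : ∀ x x' : Fin N → Bool,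
      (∀ j : Fin m, (univ.filter fun i => blk i = j ∧ x i = true).card =
        (univ.filter fun i => blk i = j ∧ x' i = true).card) → evalBool p x = evalBool p x')
    (hv : 0 < boolVariance p) :
    ∃ i : Fin N, boolVariance p ^ 2 / (64 * (d : ℝ) ^ 2 * (m : ℝ) ^ 2) ≤ influence i p := by
  -- `N ≥ 1` (else the variance vanishes), hence `m ≥ 1`
  have hN : 0 < N := by
    rcases Nat.eq_zero_or_pos N with h0 | hpos
    · exfalso
      subst h0
      have : boolVariance p = 0 := by
        unfold boolVariance boolAvg
        simp
      linarith
    · exact hpos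
  have hm : 0 < m := by
    rcases Nat.eq_zero_or_pos m with h0 | hpos
    · subst h0; exact (blk ⟨0, hN⟩).elim0
    · exact hpos
  -- the trivial case `d = 0` (`x / 0 = 0` in Lean)
  rcases Nat.eq_zero_or_pos d with hd0 | hdpos
  · subst hd0
    refine ⟨⟨0, hN⟩, ?_⟩
    simp only [Nat.cast_zero, ne_eq, OfNat.ofNat_ne_zero, not_false_eq_true, zero_pow, mul_zero, zero_mul,
      div_zero]
    exact influence_nonneg _ _
  have hd0 : (0 : ℝ) < (d : ℝ) := by exact_mod_cast hdpos
  have hm0 : (0 : ℝ) < (m : ℝ) := by exact_mod_cast hm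
  -- Efron–Stein: a block with block term `≥ Var/m`
  obtain ⟨j, hj⟩ := exists_condVar_ge hm blk (evalBool p)
  change boolVariance p / m ≤ _ at hj
  set B : Finset (Fin N) := univ.filter fun i => blk i = j with hB
  set V : ℝ := boolAvg (fun y => boolAvg (fun x => (evalBool p (Bᶜ.piecewise y x) - boolAvg (fun x => evalBool p (Bᶜ.piecewise y x))) ^ 2)) with hV
  have hVpos : 0 < V := lt_of_lt_of_le (div_pos hv hm0) hj
  -- the block restrictions `q_y`
  set q : (Fin N → Bool) → MvPolynomial (Fin B.card) ℝ := fun y =>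
    (bind₁ (fun i => if h : i ∈ B then X (B.equivFin ⟨i, h⟩) else C (if y i then (1 : ℝ) else 0)) p) with hq
  have hqdeg : ∀ y, (q y).totalDegree ≤ d := fun y => (totalDegree_blockRestrict_le B y p).trans hdeg
  have hqb : ∀ y z, 0 ≤ evalBool (q y) z ∧ evalBool (q y) z ≤ 1 := fun y z => by
    simp only [hq, evalBool_blockRestrict]; exact hb _
  have hqsym : ∀ y (z z' : Fin B.card → Bool),
      (univ.filter fun k => z k = true).card = (univ.filter fun k => z' k = true).card →
        evalBool (q y) z = evalBool (q y) z' := fun y z z' hzz =>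
    blockRestrict_symmetric blk p hsym j B (fun i => by rw [hB]; simp) y z z' hzz
  -- block term = average variance of the restrictions
  have hVeq : V = boolAvg fun y => boolVariance (q y) := by
    simp only [hV, hq, boolVariance_blockRestrict]
  -- the block is non-empty: its block term is positive
  have hn : 0 < B.card := by
    rw [Finset.card_pos]
    by_contra hempty
    rw [Finset.not_nonempty_iff_eq_empty] at hempty
    have hV0 : V = 0 := by
      rw [hV, condVar_eq_sum_sq_fourier]
      refine Finset.sum_eq_zero fun S _ => ?_
      have hS : ¬ (S.filter (· ∈ B) ≠ ∅) := by
        rw [not_not, hempty]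
        exact Finset.filter_false_of_mem fun i _ => Finset.notMem_empty i
      rw [if_neg hS]
    linarith
  have hn0 : (0 : ℝ) < (B.card : ℝ) := by exact_mod_cast hn
  -- per outside point `y`: symmetric corner + Poincaré on the restriction
  have hy : ∀ y, (B.card : ℝ) * boolVariance (q y) ^ 2 / (64 * (d : ℝ) ^ 2) ≤ ∑ k, influence k (q y) := by
    intro y
    have hVn := SymmetricCorner.boolVariance_mul_card_le_of_symmetric (q y) (hqdeg y) (hqsym y) (hqb y) hn
    have hP := four_mul_sq_sub_le_sum_influence (q y)
    rw [← boolVariance_eq_sq_sub] at hP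
    have hV0 := boolVariance_nonneg (q y)
    rw [div_le_iff₀ (by positivity)]
    have h1 : (B.card : ℝ) * boolVariance (q y) ^ 2 ≤ 256 * (d : ℝ) ^ 2 * boolVariance (q y) := by
      have := mul_le_mul_of_nonneg_left hVn hV0
      nlinarith [this]
    nlinarith [h1, hP]
  -- sum of the influences of `p` over the block = average of the total influence of the restrictions
  have hblock : ∑ i ∈ B, influence i p = boolAvg fun y => ∑ k, influence k (q y) := by
    rw [← Finset.sum_coe_sort B]
    have h1 : ∀ i : B, influence (i : Fin N) p =
        boolAvg fun y => influence (B.equivFin ⟨i, i.2⟩) (q y) := fun i =>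
      influence_eq_boolAvg_blockRestrict B p i.2
    simp_rw [h1]
    rw [← boolAvg_finset_sum]
    congr 1
    funext y
    exact Fintype.sum_equiv B.equivFin (fun i : B => influence (B.equivFin ⟨i, i.2⟩) (q y))
      (fun k => influence k (q y)) fun i => rfl
  -- average the per-`y` bound, then Jensen
  have hsumB : (B.card : ℝ) * (boolVariance p / m) ^ 2 / (64 * (d : ℝ) ^ 2) ≤ ∑ i ∈ B, influence i p := by
    rw [hblock]
    have hJ : V ^ 2 ≤ boolAvg fun y => boolVariance (q y) ^ 2 := by
      rw [hVeq]; exact boolAvg_sq_le_boolAvg_sq _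
    have hVm : (boolVariance p / m) ^ 2 ≤ V ^ 2 :=
      pow_le_pow_left₀ (div_nonneg hv.le hm0.le) hj 2
    calc (B.card : ℝ) * (boolVariance p / m) ^ 2 / (64 * (d : ℝ) ^ 2)
        ≤ (B.card : ℝ) * (boolAvg fun y => boolVariance (q y) ^ 2) / (64 * (d : ℝ) ^ 2) := by
          gcongr
          exact hVm.trans hJ
      _ = boolAvg fun y => (B.card : ℝ) * boolVariance (q y) ^ 2 / (64 * (d : ℝ) ^ 2) := by
          rw [show (fun y => (B.card : ℝ) * boolVariance (q y) ^ 2 / (64 * (d : ℝ) ^ 2)) =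
              fun y => ((B.card : ℝ) / (64 * (d : ℝ) ^ 2)) * boolVariance (q y) ^ 2 from funext fun y => by ring,
            avg_const_mul]
          ring
      _ ≤ boolAvg fun y => ∑ k, influence k (q y) := boolAvg_mono hy
  -- pigeonhole over the block
  have hBne : B.Nonempty := Finset.card_pos.mp hn
  have hconst : ∑ _i ∈ B, (boolVariance p / m) ^ 2 / (64 * (d : ℝ) ^ 2) ≤ ∑ i ∈ B, influence i p := by
    rw [Finset.sum_const, nsmul_eq_mul, ← mul_div_assoc]
    exact hsumB
  obtain ⟨i, -, hi⟩ := Finset.exists_le_of_sum_le hBne hconst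
  refine ⟨i, le_trans (le_of_eq ?_) hi⟩
  field_simp

/-- **The statement of the route decl `AAConj` on the block-symmetric corner**, shape `(c, C) = (2, 1/(64 m²))`:
every `[0,1]`-bounded `p` of total degree `≤ d`, symmetric inside each of `m` blocks, with `0 < ε ≤ Var[p]`, has a
variable with `(1/(64 m²))·(ε/d)² ≤ Inf_i[p]`. [cite: AaronsonAmbainis2014, Conj. 6] -/
theorem aaConj_blockSymmetricCorner {m : ℕ} (blk : Fin N → Fin m) (d : ℕ) (p : MvPolynomial (Fin N) ℝ) (ε : ℝ)
    (hsym : ∀ x x' : Fin N → Bool,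
      (∀ j : Fin m, (univ.filter fun i => blk i = j ∧ x i = true).card =
        (univ.filter fun i => blk i = j ∧ x' i = true).card) → evalBool p x = evalBool p x')
    (hdeg : p.totalDegree ≤ d) (hb : ∀ x, 0 ≤ evalBool p x ∧ evalBool p x ≤ 1)
    (hε : 0 < ε) (hεV : ε ≤ boolVariance p) :
    ∃ i : Fin N, (1 / (64 * (m : ℝ) ^ 2)) * (ε / d) ^ 2 ≤ influence i p := by
  obtain ⟨i, hi⟩ := exists_influence_ge_of_blockSymmetric blk p hdeg hb hsym (lt_of_lt_of_le hε hεV)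
  refine ⟨i, le_trans ?_ hi⟩
  have hm : (0 : ℝ) < (m : ℝ) ^ 2 := by
    have hN : 0 < N := by
      rcases Nat.eq_zero_or_pos N with h0 | hpos
      · exfalso; subst h0
        have : boolVariance p = 0 := by unfold boolVariance boolAvg; simp
        linarith
      · exact hpos
    have : 0 < m := by
      rcases Nat.eq_zero_or_pos m with h0 | hpos
      · subst h0; exact (blk ⟨0, hN⟩).elim0
      · exact hpos
    positivity
  rcases Nat.eq_zero_or_pos d with hd0 | hdpos
  · subst hd0
    simp
  have hd : (0 : ℝ) < (d : ℝ) := by exact_mod_cast hdpos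
  rw [div_pow, show (1 / (64 * (m : ℝ) ^ 2)) * (ε ^ 2 / (d : ℝ) ^ 2) = ε ^ 2 / (64 * (d : ℝ) ^ 2 * (m : ℝ) ^ 2) by
    field_simp]
  exact div_le_div_of_nonneg_right (pow_le_pow_left₀ hε.le hεV 2) (by positivity)

/-- **The statement of the route decl `SosSandwich.PseudoBoundedAA` (stmt-QuantumAdvantage-15237) on the block-symmetric
corner**, shape `(c, C) = (2, 1/(256 m²))`: a pseudo-bounded `p` of order `T` (so of degree `≤ 2T` on the cube) whose
cube values depend only on the weights inside each of `m` blocks of variables, with `0 < ε ≤ Var[p]`, has a variable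
with `(1/(256 m²))·(ε/T)² ≤ Inf_i[p]`.  For `m = 1` this is the tree's sharp symmetric corner; the loss in the number
of blocks is polynomial. [cite: AaronsonAmbainis2014, Conj. 6] [cite: KaniewskiLeeDewolf2015, Def. 7] -/
theorem pseudoBoundedAA_blockSymmetricCorner {m : ℕ} (blk : Fin N → Fin m) (T : ℕ) (p : MvPolynomial (Fin N) ℝ)
    (ε : ℝ)
    (hsym : ∀ x x' : Fin N → Bool,
      (∀ j : Fin m, (univ.filter fun i => blk i = j ∧ x i = true).card =
        (univ.filter fun i => blk i = j ∧ x' i = true).card) → evalBool p x = evalBool p x')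
    (hpb : PseudoBounded T p) (hε : 0 < ε) (hεV : ε ≤ boolVariance p) :
    ∃ i : Fin N, (1 / (256 * (m : ℝ) ^ 2)) * (ε / T) ^ 2 ≤ influence i p := by
  -- a representing polynomial of total degree `≤ 2T` with the same cube values
  obtain ⟨M, q, r, hqr, hval⟩ := hpb
  set P : MvPolynomial (Fin N) ℝ := ∑ j, q j ^ 2 with hP
  have hPdeg : P.totalDegree ≤ 2 * T := by
    refine (MvPolynomial.totalDegree_finsetSum _ _).trans (Finset.sup_le fun j _ => ?_)
    calc (q j ^ 2).totalDegree ≤ 2 * (q j).totalDegree := MvPolynomial.totalDegree_pow _ _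
      _ ≤ 2 * T := Nat.mul_le_mul_left 2 (hqr j).1
  have hPval : ∀ x, evalBool P x = evalBool p x := by
    intro x
    unfold evalBool
    rw [hP, map_sum]
    have h1 := (hval x).1
    change evalBool p x = ∑ j, evalBool (q j) x ^ 2 at h1
    unfold evalBool at h1
    rw [h1]
    exact Finset.sum_congr rfl fun j _ => by rw [map_pow]
  have hPval' : evalBool P = evalBool p := funext hPval
  have hbP : ∀ x, 0 ≤ evalBool P x ∧ evalBool P x ≤ 1 := fun x => by
    rw [hPval]
    exact ⟨PseudoBounded.eval_nonneg ⟨M, q, r, hqr, hval⟩ x, PseudoBounded.eval_le_one ⟨M, q, r, hqr, hval⟩ x⟩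
  have hsymP : ∀ x x' : Fin N → Bool,
      (∀ j : Fin m, (univ.filter fun i => blk i = j ∧ x i = true).card =
        (univ.filter fun i => blk i = j ∧ x' i = true).card) → evalBool P x = evalBool P x' := fun x x' h => by
    rw [hPval, hPval]; exact hsym x x' h
  have hVP : boolVariance P = boolVariance p := by unfold boolVariance; rw [hPval']
  have hIP : ∀ i, influence i P = influence i p := fun i => by unfold influence; rw [hPval']
  obtain ⟨i, hi⟩ := aaConj_blockSymmetricCorner blk (2 * T) P ε hsymP hPdeg hbP hε (hVP ▸ hεV)
  refine ⟨i, le_trans (le_of_eq ?_) ((hIP i) ▸ hi)⟩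
  push_cast
  ring

end Summit.QuantumAdvantage.QuantumAdvantage.Theorems.SosSandwich.BlockSymmetricCorner

end
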